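import Literature.MathematicalPhysics.QuantumFieldTheory.ConformalBootstrap3D.RadialConversion
import HarnessLib

/-!
# Parity of the radial table is a theorem (Hogervorst–Rychkov 2013 eq. (2.15) and §3; Costa et al. 2016 §2.1)

In the radial (Gegenbauer) expansion of a conformal block the spin `j` exchanged at level `m` satisfies
`j ≡ ℓ + m (mod 2)`: Hogervorst–Rychkov 2013, §2.1 eq. (2.15) (TeX label `eq:j`; arXiv:1303.1111v2 =
journal numbering of sections) lists the spins at level `n` as `j = ℓ+n, ℓ+n-2, …, max(ℓ-n, (ℓ+n) mod 2)`,
and §3 (sentence after eq. (3.3), with the footnote "the exchange `1 ↔ 2` corresponds to `z → z/(z-1)`,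
which is equivalent to `ρ → -ρ`") states that in the `ρ`-expansion "the spins `j` at level `n` will still
be subject to the constraint (2.15)". Costa–Hansen–Penedones–Trevisani 2016 §2.1 print the SUPPORT
condition only (eq. (2.15) there: `w(m,j) = 0` for `|j - ℓ| > m`; the parity is visible in their Fig. 1).
The tree's radial pair clause `RadialPairClause` (the would-be block clause A2ρ at one point,
`MixedOddRadialRules`) likewise only records the support condition `j ≤ ℓ + m`, while its signed expansion
`HasSignedRadialExpansion` is stated with the level sign `(-1)^m` — which agrees with the `x₁ ↔ x₂` sign
`(-1)^{ℓ+j}` only on the parity support (pub-ising3d REFEREE.md F81). This file shows that no parity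
clause needs to be ADDED: for a typed block of the conjugate-pair family (`Δ₁₂ = -Δ₃₄`) at a regular
`(Δ,ℓ)`, ANY supported radial table of `((1-z)(1-z̄))^c g` is parity-supported
(`IsConformalBlock3D.radial_paritySupport`), because by the conversion theorem `RadialConversion` its
`(√ρ,√ρ̄)`-monomial array is the conversion of the Dolan–Osborn `z`-array, which lives on the descendant
range `j ≡ ℓ + n` (`hrCoeffAB_eq_zero_of_not_inDescendantRange`), so only EVEN monomial degrees occur
(`zRhoConv_eq_zero_of_odd`), and a supported table whose monomial array vanishes at odd degrees has no
odd-parity entries (`RadialSupport.paritySupport_of_radialMonArr`; the Legendre triangularity of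
`RadialExpansionUniqueness` restricted to one parity class). Consequently the table of `RadialPairClause`
is parity-supported (`RadialPairClause.exists_paritySupport`) and on it `(-1)^m = (-1)^{ℓ+j}`
(`neg_one_pow_level_eq_of_paritySupport`, `ParitySupport.hasSignedRadialExpansion_iff_spinSign`).

Sources: M. Hogervorst, S. Rychkov, Phys. Rev. D 87 (2013) 106004, arXiv:1303.1111, §2.1 eq. (2.15), §3;
M. S. Costa, T. Hansen, J. Penedones, E. Trevisani, JHEP 07 (2016) 057, arXiv:1603.05552, §2.1
eqs. (2.11), (2.15). (Equation numbers checked against the arXiv TeX sources of both papers; note that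
several older files of this directory quote Hogervorst–Rychkov displays by a legacy numbering in which
their `𝒫_{E,j}` ansatz — TeX label `eq:ansatz`, arXiv eq. (2.24) — is called "(3.6)".)
Tree: `RadialConversion` (`zRhoConv`, `convCoeff`, `convDeg`, `IsConformalBlock3D.radialMonArr_eq_zRhoConv`,
`RadialSupport.eq_zero_of_radialMonArr_eq_zero`), `RadialExpansionUniqueness` (`radialArr`, `radialMonArr`,
`RadialSupport`), `MixedBlockCoefficients` (`hrCoeffAB_eq_zero_of_not_inDescendantRange`).
-/

namespace Literature.MathematicalPhysics.QuantumFieldTheory.ConformalBootstrap3D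

open Finset Set

/-- A table `d(m,j)` with base spin `ℓ` is *parity-supported* when `d(m,j) = 0` unless
`j ≡ ℓ + m (mod 2)` (Hogervorst–Rychkov 2013 §2.1 eq. (2.15) and §3 after eq. (3.3)).
[cite: HogervorstRychkov2013, §2.1 eq. (2.15)] -/
def ParitySupport (ℓ : ℕ) (d : ℕ × ℕ → ℝ) : Prop :=
  ∀ q : ℕ × ℕ, (ℓ + q.1 + q.2) % 2 = 1 → d q = 0

/-- The Dolan–Osborn `z`-array `A_{n,j}(a,b)/λ_ℓ` is parity-supported (it lives on the descendant range).
[cite: HogervorstRychkov2013, §2.1 eq. (2.15)] -/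
theorem paritySupport_hrCoeffAB (a b Δ : ℝ) (ℓ : ℕ) :
    ParitySupport ℓ (fun q : ℕ × ℕ => hrCoeffAB a b Δ ℓ q.1 q.2 / legendreLam ℓ) := by
  intro q hq
  simp only
  rw [hrCoeffAB_eq_zero_of_not_inDescendantRange a b Δ (fun hr => by
    obtain ⟨-, -, h3⟩ := hr
    omega), zero_div]

/-- A non-zero entry of `radialArr N j` at `(a,b)` forces `a ≡ N - j (mod 2)`. [folklore] -/
theorem radialArr_eq_zero_of_parity {N j a b : ℕ} (h : (a + (N - j)) % 2 = 1) : radialArr N j (a, b) = 0 := by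
  unfold radialArr
  rw [if_neg]
  rintro ⟨-, h2, -, -, h5⟩
  simp only at h2 h5
  omega

/-- **The conversion array has no odd degrees** when the `z`-array is supported on the descendant range
(`j ≤ ℓ + n`, `j ≡ ℓ + n`): every conversion index in the fibre of an odd degree carries a vanishing
coefficient. [cite: HogervorstRychkov2013, §3 "first method"] -/
theorem zRhoConv_eq_zero_of_odd (c Δ : ℝ) {ℓ : ℕ} {A : ℕ × ℕ → ℝ} (hAp : ParitySupport ℓ A)
    (hAs : RadialSupport ℓ A) {p : ℕ × ℕ} (hp : p.1 % 2 = 1) : zRhoConv c Δ ℓ A p = 0 := by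
  unfold zRhoConv
  have hfun : (fun τ : ↥(convDeg ℓ ⁻¹' {p}) => convCoeff c Δ ℓ A (τ : ConvIndex)) = fun _ => 0 := by
    funext τ
    have hτ : convDeg ℓ (τ : ConvIndex) = p := τ.2
    unfold convCoeff
    split_ifs with hik
    · by_cases hA0 : A (τ : ConvIndex).1 = 0
      · rw [hA0]; ring
      · exfalso
        have h1 : (τ : ConvIndex).1.2 ≤ ℓ + (τ : ConvIndex).1.1 := by
          by_contra h
          exact hA0 (hAs _ (by rw [not_le] at h; exact h))
        have h2 : (ℓ + (τ : ConvIndex).1.1 + (τ : ConvIndex).1.2) % 2 = 0 := by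
          by_contra h
          exact hA0 (hAp _ (by omega))
        have hdeg := congrArg Prod.fst hτ
        unfold convDeg convOffset at hdeg
        simp only at hdeg
        omega
    · rfl
  rw [hfun, tsum_zero]

/-- **Odd-degree vanishing of the monomial array forces parity of the table.** If `w` is supported on
`j ≤ ℓ + m` and its `(√ρ,√ρ̄)`-monomial array vanishes at every odd degree `a`, then `w(m,j) = 0`
whenever `j ≢ ℓ + m (mod 2)` (the odd-parity part of `w` has a monomial array living on odd degrees only,
hence vanishing identically, hence is zero by the Legendre triangularity). [folklore] -/
theorem RadialSupport.paritySupport_of_radialMonArr {ℓ : ℕ} {w : ℕ × ℕ → ℝ} (hw : RadialSupport ℓ w)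
    (hZ : ∀ p : ℕ × ℕ, p.1 % 2 = 1 → radialMonArr ℓ w p = 0) : ParitySupport ℓ w := by
  classical
  -- the odd-parity part of `w`
  set wo : ℕ × ℕ → ℝ := fun q => if (ℓ + q.1 + q.2) % 2 = 1 then w q else 0 with hwo
  have hwos : RadialSupport ℓ wo := fun q hq => by
    rw [hwo]
    simp only
    split_ifs
    · exact hw q hq
    · rfl
  have hzero : radialMonArr ℓ wo = 0 := by
    funext p
    obtain ⟨a, b⟩ := p
    rw [Pi.zero_apply]
    by_cases hg : (a + b) % 2 = 0 ∧ 2 * ℓ ≤ a + b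
    · obtain ⟨m, hm⟩ : ∃ m, a + b = 2 * (ℓ + m) := ⟨(a + b) / 2 - ℓ, by omega⟩
      have hp : (a, b) ∈ antidiagonal (2 * (ℓ + m)) := by rw [mem_antidiagonal]; exact hm
      rw [radialMonArr_of_mem wo hp]
      by_cases ha : a % 2 = 1
      · -- odd degree: the even-parity entries do not reach `a`, so the sum is that of `w`
        have hsum : ∑ j ∈ range (ℓ + m + 1), wo (m, j) * radialArr (ℓ + m) j (a, b) =
            ∑ j ∈ range (ℓ + m + 1), w (m, j) * radialArr (ℓ + m) j (a, b) := by
          refine sum_congr rfl fun j hj => ?_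
          rw [hwo]
          simp only
          split_ifs with hpar
          · rfl
          · have hj' := Finset.mem_range.mp hj
            rw [radialArr_eq_zero_of_parity (by omega), mul_zero, mul_zero]
        rw [hsum, ← radialMonArr_of_mem w hp]
        exact hZ (a, b) ha
      · -- even degree: the odd-parity entries do not reach `a`
        refine sum_eq_zero fun j hj => ?_
        rw [hwo]
        simp only
        split_ifs with hpar
        · have hj' := Finset.mem_range.mp hj
          rw [radialArr_eq_zero_of_parity (by omega), mul_zero]
        · rw [zero_mul]
    · unfold radialMonArr
      rw [if_neg hg]
  have hwo0 := hwos.eq_zero_of_radialMonArr_eq_zero hzero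
  intro q hq
  have h := congrFun hwo0 q
  rw [hwo] at h
  simp only [if_pos hq, Pi.zero_apply] at h
  exact h

/-- **Parity of the radial table of a typed block** (HR13 eq. (2.15) in the `ρ`-frame, §3, as a
theorem). For a genuine block with `Δ₁₂ = -Δ₃₄` at a regular `(Δ,ℓ)`, any table `w` supported on
`j ≤ ℓ + m` with `HasRadialExpansion c Δ w g` satisfies `w(m,j) = 0` unless `j ≡ ℓ + m (mod 2)`.
[cite: HogervorstRychkov2013, §3 after eq. (3.3)] -/
theorem IsConformalBlock3D.radial_paritySupport {Δ₁₂ Δ₃₄ Δ c : ℝ} {ℓ : ℕ} {g : ℝ → ℝ → ℝ}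
    {w : ℕ × ℕ → ℝ} (hΔ : unitarityBound3D ℓ < Δ) (hreg : ¬ accidentalDegeneracy3D Δ ℓ)
    (hab : Δ₁₂ = -Δ₃₄) (hg : IsConformalBlock3D Δ₁₂ Δ₃₄ Δ ℓ g) (hw : RadialSupport ℓ w)
    (hρ : HasRadialExpansion c Δ w g) : ParitySupport ℓ w := by
  refine hw.paritySupport_of_radialMonArr fun p hp => ?_
  rw [hg.radialMonArr_eq_zRhoConv hΔ hreg hab hw hρ]
  exact zRhoConv_eq_zero_of_odd c Δ (paritySupport_hrCoeffAB _ _ Δ ℓ)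
    (fun q hq => by simp only; rw [hrCoeffAB_eq_zero_of_lt _ _ _ hq, zero_div]) hp

/-- **The radial pair clause yields a parity-supported table** (REFEREE F81 discharged as a theorem:
at a regular point no parity clause needs to be added to A2ρ). Under `RadialPairClause Δσ Δε Δ ℓ`, for
any typed odd-sector pair `(g₁, g₂)` the clause's (unique) table is non-negative, supported on
`j ≤ ℓ + m`, parity-supported, and gives both expansions.
[cite: CostaHansenPenedonesTrevisani2016, §2.1 eqs. (2.11), (2.15)]
[cite: HogervorstRychkov2013, §3 after eq. (3.3)] -/
theorem RadialPairClause.exists_paritySupport {Δσ Δε Δ : ℝ} {ℓ : ℕ} (h : RadialPairClause Δσ Δε Δ ℓ)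
    (hΔ : unitarityBound3D ℓ < Δ) (hreg : ¬ accidentalDegeneracy3D Δ ℓ) {g₁ g₂ : ℝ → ℝ → ℝ}
    (hg₁ : IsConformalBlock3D (Δσ - Δε) (Δσ - Δε) Δ ℓ g₁)
    (hg₂ : IsConformalBlock3D (-(Δσ - Δε)) (Δσ - Δε) Δ ℓ g₂) :
    ∃ wr : ℕ × ℕ → ℝ, (∀ q, 0 ≤ wr q) ∧ RadialSupport ℓ wr ∧ ParitySupport ℓ wr ∧
      HasSignedRadialExpansion Δ wr g₁ ∧ HasRadialExpansion ((Δσ - Δε) / 2) Δ wr g₂ := by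
  obtain ⟨wr, hw, hsupp, h₁, h₂⟩ := h g₁ g₂ hg₁ hg₂
  exact ⟨wr, hw, hsupp, hg₂.radial_paritySupport hΔ hreg rfl hsupp h₂, h₁, h₂⟩

/-- On a parity-supported table the level sign `(-1)^m` of `HasSignedRadialExpansion` equals the
`x₁ ↔ x₂` sign `(-1)^{ℓ+j}` wherever the table is non-zero. [folklore] -/
theorem neg_one_pow_level_eq_of_paritySupport {ℓ : ℕ} {w : ℕ × ℕ → ℝ} (hw : ParitySupport ℓ w)
    (q : ℕ × ℕ) : (-1 : ℝ) ^ q.1 * w q = (-1 : ℝ) ^ (ℓ + q.2) * w q := by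
  by_cases hq : (ℓ + q.1 + q.2) % 2 = 1
  · rw [hw q hq, mul_zero, mul_zero]
  · have hev : Even (q.1 + (ℓ + q.2)) := by rw [Nat.even_iff]; omega
    congr 1
    rcases Nat.even_or_odd q.1 with h1 | h1
    · have h2 : Even (ℓ + q.2) := by
        rcases Nat.even_or_odd (ℓ + q.2) with h2 | h2
        · exact h2
        · exact absurd hev (Nat.not_even_iff_odd.mpr (h1.add_odd h2))
      rw [h1.neg_one_pow, h2.neg_one_pow]
    · have h2 : Odd (ℓ + q.2) := by
        rcases Nat.even_or_odd (ℓ + q.2) with h2 | h2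
        · exact absurd hev (Nat.not_even_iff_odd.mpr (h1.add_even h2))
        · exact h2
      rw [h1.neg_one_pow, h2.neg_one_pow]

/-- On a parity-supported table the signed radial expansion (level sign `(-1)^m`) is literally the
`x₁ ↔ x₂` image expansion with sign `(-1)^{ℓ+j}` (REFEREE F81's preferred spelling). [folklore] -/
theorem ParitySupport.hasSignedRadialExpansion_iff_spinSign {ℓ : ℕ} {Δ : ℝ} {w : ℕ × ℕ → ℝ}
    {g : ℝ → ℝ → ℝ} (hw : ParitySupport ℓ w) :
    HasSignedRadialExpansion Δ w g ↔
      HasRadialExpansion 0 Δ (fun q => (-1 : ℝ) ^ (ℓ + q.2) * w q) g := by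
  have hfun : (fun q : ℕ × ℕ => (-1 : ℝ) ^ q.1 * w q) = fun q => (-1 : ℝ) ^ (ℓ + q.2) * w q :=
    funext fun q => neg_one_pow_level_eq_of_paritySupport hw q
  rw [hasSignedRadialExpansion_iff, hfun]

end Literature.MathematicalPhysics.QuantumFieldTheory.ConformalBootstrap3D
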